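import Summits.ValiantsHypothesis.ValiantsHypothesis.Theorems.BarrierLeverTropicalDetCertificateSuffices

/-!
# Route BarrierLever — the FREE PAIR KERNEL is totally nonsingular (𝒟-side door (c); `--supports`
# stmt-ValiantsHypothesis-19152 `TransversalMinorLayoutsNonsingular`)

Cell valiant-natproofs, rung V4, prover seat val-np-p2 (g4). Closes NO item.

**What.** The resultant-kernel conjecture CT (`Theses.BarrierLever.TransversalResultantKernelNonsingular`,
which implies TT = item 19152 through the proved arrow `ResultantKernelSufficesForTransversal`) asks for
points `p q : Fin (h+h) → ℂ` making the `r × r` matrix `(∏_{a,c} (p (ρ_{u_i} a) − q (τ_{w_j} c)))_{i,j}` of a pair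
of injective layouts nonsingular (`ρ`, `τ` = the TT literal maps). We prove the statement obtained by replacing
the differences `p k − q l` by a FREE table `Z k l` on the literal pairs:

* `exists_freePairKernel_det_ne_zero` — for all `h r` and injective `u w : Fin r → Finset (Fin h)` there is
  `Z : Fin (h+h) → Fin (h+h) → ℂ` with `det (∏_a ∏_c Z (ρ_{u_i} a) (τ_{w_j} c))_{i,j} ≠ 0`;
* `freePairKernel_det_ne_zero` — the same determinant with independent indeterminates
  `X (k, l)` (in `MvPolynomial (Fin (h+h) × Fin (h+h)) ℤ`) is a nonzero polynomial.

So the entire content of CT is the specialisation `Z k l = p k − q l` (tropically: the restriction of the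
pair weights to tree-metric / cross-ratio form); with free pair weights the kernel is certified by ONE
weight for every layout pair at once.

**Proof.** Put `Z k l := t ^ (α k * β l)` with `α (castAdd a) = 2^a`, `α (natAdd a) = 0`, `β (natAdd c) = 2^c`,
`β (castAdd c) = 0` (written on indices: `α k = if k < h then 2^k else 0`, `β l = if l < h then 0 else 2^(l−h)`). Then `∏_{a,c} Z (ρ_{u_i} a) (τ_{w_j} c) = t ^ (A i * B j)` with `A i = Σ_{a ∈ u i} 2^a`,
`B j = Σ_{c ∈ w j} 2^c` — injective in `i` resp. `j` (binary expansions, `Finset.equivBitIndices`). In the Leibniz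
expansion of `det (T ^ (A i * B j)) ∈ ℤ[T]` the exponent `Σ_j A (σ j) * B j` has a UNIQUE maximiser `σ₀` (the
co-monotone bijection: a maximiser cannot contain an inversion — swapping it gains
`(A − A')(B' − B) > 0` — and two inversion-free bijections agree because the `A`-rank of `σ j` equals the `B`-rank
of `j`), so the polynomial is nonzero (`TropicalDet.det_ne_zero_of_unique_maxDegree`) and some natural number `t`
is not a root.

WHAT THIS IS NOT: CT, TT, TNS, item 19717, crux 14610 and `VP ≠ VNP` are untouched; this is the free relaxation
of CT only (memo HOME/val-np-p2/UNIVERSAL-UTD-g4.md §5 for the tropical reading).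
-/

-- layout Summits/ValiantsHypothesis/ValiantsHypothesis forces the duplicated namespace component
set_option linter.dupNamespace false

namespace Summit.ValiantsHypothesis.ValiantsHypothesis.Theorems.BarrierLever.FreePairKernel

open Finset Polynomial

section Combinatorics

variable {r : ℕ}

/-- Swapping two positions of a bijection with an inversion strictly increases the exponent. -/
theorem expo_swap_lt (A B : Fin r → ℕ) (σ : Equiv.Perm (Fin r)) (j j' : Fin r)
    (hB : B j < B j') (hA : A (σ j') < A (σ j)) :
    ∑ k, A (σ k) * B k < ∑ k, A ((σ * Equiv.swap j j') k) * B k := by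
  classical
  have hjj : j ≠ j' := by rintro rfl; exact lt_irrefl _ hB
  -- split off the two positions `j`, `j'`
  have hsplit : ∀ τ : Equiv.Perm (Fin r), ∑ k, A (τ k) * B k =
      A (τ j) * B j + A (τ j') * B j' + ∑ k ∈ (univ.erase j).erase j', A (τ k) * B k := by
    intro τ
    rw [← Finset.add_sum_erase _ _ (mem_univ j), ← Finset.add_sum_erase _ _
      (Finset.mem_erase.mpr ⟨hjj.symm, mem_univ j'⟩), add_assoc]
  rw [hsplit σ, hsplit (σ * Equiv.swap j j')]
  have hrest : ∑ k ∈ (univ.erase j).erase j', A ((σ * Equiv.swap j j') k) * B k =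
      ∑ k ∈ (univ.erase j).erase j', A (σ k) * B k := by
    refine Finset.sum_congr rfl fun k hk => ?_
    have hk1 : k ≠ j' := (Finset.mem_erase.mp hk).1
    have hk2 : k ≠ j := (Finset.mem_erase.mp (Finset.mem_erase.mp hk).2).1
    rw [Equiv.Perm.mul_apply, Equiv.swap_apply_of_ne_of_ne hk2 hk1]
  rw [hrest, Equiv.Perm.mul_apply, Equiv.Perm.mul_apply, Equiv.swap_apply_left,
    Equiv.swap_apply_right]
  -- `A(σ j) B j + A(σ j') B j' < A(σ j') B j + A(σ j) B j'`
  have key : A (σ j) * B j + A (σ j') * B j' < A (σ j') * B j + A (σ j) * B j' := by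
    obtain ⟨d, hd⟩ := Nat.exists_eq_add_of_lt hA
    obtain ⟨e, he⟩ := Nat.exists_eq_add_of_lt hB
    rw [hd, he]
    nlinarith
  omega

/-- A maximiser of the exponent has no inversion. -/
theorem noInversion_of_max (A B : Fin r → ℕ) (σ : Equiv.Perm (Fin r))
    (hmax : ∀ τ : Equiv.Perm (Fin r), ∑ k, A (τ k) * B k ≤ ∑ k, A (σ k) * B k) (j j' : Fin r)
    (hB : B j < B j') : A (σ j) ≤ A (σ j') := by
  by_contra hlt
  exact absurd (hmax (σ * Equiv.swap j j')) (not_le.mpr (expo_swap_lt A B σ j j' hB (not_le.mp hlt)))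

/-- The `A`-rank `#{i' | A i' < A i}` is strictly monotone in the `A`-value. -/
theorem rankOf_lt_of_lt (A : Fin r → ℕ) {i i' : Fin r} (h : A i < A i') :
    (univ.filter fun k => A k < A i).card < (univ.filter fun k => A k < A i').card := by
  apply Finset.card_lt_card
  refine ⟨fun k hk => ?_, fun hsub => ?_⟩
  · simp only [mem_filter, mem_univ, true_and] at hk ⊢
    exact hk.trans h
  · have : i ∈ univ.filter fun k => A k < A i' := by simp [h]
    have hi := hsub this
    simp at hi

/-- The `A`-rank is injective when `A` is. -/
theorem rankOf_injective (A : Fin r → ℕ) (hA : Function.Injective A) :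
    Function.Injective (fun i => (univ.filter fun k => A k < A i).card) := by
  intro i i' hii
  by_contra hne
  rcases lt_or_gt_of_ne (fun heq => hne (hA heq)) with hlt | hgt
  · exact absurd hii (ne_of_lt (rankOf_lt_of_lt A hlt))
  · exact absurd hii (ne_of_gt (rankOf_lt_of_lt A hgt))

/-- For an inversion-free bijection the `A`-rank of `σ j` is the `B`-rank of `j`. -/
theorem rankOf_comp_eq (A B : Fin r → ℕ) (hA : Function.Injective A) (hB : Function.Injective B)
    (σ : Equiv.Perm (Fin r)) (hmono : ∀ j j', B j < B j' → A (σ j) ≤ A (σ j')) (j : Fin r) :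
    (univ.filter fun k => A k < A (σ j)).card = (univ.filter fun k => B k < B j).card := by
  -- strict monotonicity along `σ`
  have hsm : ∀ k k', B k < B k' ↔ A (σ k) < A (σ k') := by
    intro k k'
    constructor
    · intro hkk
      exact lt_of_le_of_ne (hmono k k' hkk) fun heq => (ne_of_lt hkk) (congrArg B (σ.injective (hA heq)) ▸ rfl)
    · intro hkk
      rcases lt_trichotomy (B k) (B k') with hlt | heq | hgt
      · exact hlt
      · exact absurd (congrArg (fun t => A (σ t)) (hB heq)) (ne_of_lt hkk)
      · exact absurd hkk (not_lt.mpr (hmono k' k hgt))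
  -- the filter for `A` is the `σ`-image of the filter for `B`
  have himg : (univ.filter fun i' => A i' < A (σ j)) = (univ.filter fun k => B k < B j).image σ := by
    ext i'
    simp only [mem_filter, mem_univ, true_and, mem_image]
    constructor
    · intro hi'
      refine ⟨σ.symm i', ?_, σ.apply_symm_apply i'⟩
      rw [hsm, σ.apply_symm_apply]; exact hi'
    · rintro ⟨k, hk, rfl⟩
      exact (hsm k j).mp hk
  rw [himg, Finset.card_image_of_injective _ σ.injective]

/-- **Unique maximiser.** If `A` and `B` are injective then the exponent `Σ_j A (σ j) * B j` has a unique
maximiser over the permutations `σ`. -/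
theorem exists_unique_max (A B : Fin r → ℕ) (hA : Function.Injective A) (hB : Function.Injective B) :
    ∃ σ₀ : Equiv.Perm (Fin r), ∀ σ, σ ≠ σ₀ → ∑ k, A (σ k) * B k < ∑ k, A (σ₀ k) * B k := by
  classical
  obtain ⟨σ₀, -, hmax⟩ := Finset.exists_max_image (univ : Finset (Equiv.Perm (Fin r)))
    (fun τ => ∑ k, A (τ k) * B k) ⟨1, mem_univ _⟩
  refine ⟨σ₀, fun σ hσ => lt_of_le_of_ne (hmax σ (mem_univ σ)) fun heq => hσ ?_⟩
  -- `σ` is also a maximiser, hence inversion-free; two inversion-free bijections coincide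
  have hmaxσ : ∀ τ : Equiv.Perm (Fin r), ∑ k, A (τ k) * B k ≤ ∑ k, A (σ k) * B k :=
    fun τ => heq ▸ hmax τ (mem_univ τ)
  have h1 := rankOf_comp_eq A B hA hB σ (noInversion_of_max A B σ hmaxσ)
  have h0 := rankOf_comp_eq A B hA hB σ₀ (noInversion_of_max A B σ₀ fun τ => hmax τ (mem_univ τ))
  ext j
  exact congrArg Fin.val (rankOf_injective A hA ((h1 j).trans (h0 j).symm))

end Combinatorics

section Kernel

variable {h : ℕ}

/-- Row weight of a literal (`2^a` on `castAdd h a`, `0` on `natAdd h a`), written on the literal index: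
positive literals are exactly the indices `< h`. -/
theorem rowW_ite (x : Finset (Fin h)) (a : Fin h) :
    (fun k : Fin (h + h) => if (k : ℕ) < h then 2 ^ (k : ℕ) else 0)
      (if a ∈ x then Fin.castAdd h a else Fin.natAdd h a) = if a ∈ x then 2 ^ (a : ℕ) else 0 := by
  by_cases ha : a ∈ x
  · simp only [if_pos ha, Fin.val_castAdd, if_pos a.isLt]
  · simp only [if_neg ha, Fin.val_natAdd]
    rw [if_neg (by omega)]

/-- Column weight of a literal (`2^c` on `natAdd h c`, `0` on `castAdd h c`). -/
theorem colW_ite (y : Finset (Fin h)) (c : Fin h) :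
    (fun l : Fin (h + h) => if (l : ℕ) < h then 0 else 2 ^ ((l : ℕ) - h))
      (if c ∈ y then Fin.natAdd h c else Fin.castAdd h c) = if c ∈ y then 2 ^ (c : ℕ) else 0 := by
  by_cases hc : c ∈ y
  · simp only [if_pos hc, Fin.val_natAdd]
    rw [if_neg (by omega), Nat.add_sub_cancel_left]
  · simp only [if_neg hc, Fin.val_castAdd, if_pos c.isLt]

/-- The indicator weights of a point sum to its binary code `Σ_{a ∈ x} 2^a`. -/
theorem sum_ite_eq_code (x : Finset (Fin h)) :
    ∑ a : Fin h, (if a ∈ x then 2 ^ (a : ℕ) else 0) = ∑ a ∈ x, 2 ^ (a : ℕ) := by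
  rw [← Finset.sum_filter, Finset.filter_mem_eq_inter, Finset.univ_inter]

/-- Binary codes `x ↦ Σ_{a ∈ x} 2^a` are injective (binary expansion, `Finset.equivBitIndices`). -/
theorem code_injective : Function.Injective (fun x : Finset (Fin h) => ∑ a ∈ x, 2 ^ (a : ℕ)) := by
  intro x y hxy
  simp only at hxy
  have hx : ∑ a ∈ x, 2 ^ (a : ℕ) = ∑ n ∈ x.map Fin.valEmbedding, 2 ^ n := by
    rw [Finset.sum_map]; rfl
  have hy : ∑ a ∈ y, 2 ^ (a : ℕ) = ∑ n ∈ y.map Fin.valEmbedding, 2 ^ n := by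
    rw [Finset.sum_map]; rfl
  rw [hx, hy] at hxy
  have : x.map Fin.valEmbedding = y.map Fin.valEmbedding := by
    have e := congrArg Finset.equivBitIndices hxy
    rwa [← Finset.equivBitIndices_symm_apply, ← Finset.equivBitIndices_symm_apply,
      Equiv.apply_symm_apply, Equiv.apply_symm_apply] at e
  exact Finset.map_injective Fin.valEmbedding this

/-- The specialised entry: `∏_a ∏_c t^(w_row (ρ a) * w_col (τ c)) = t ^ (code u * code w)`. -/
theorem prod_prod_pow_eq {R : Type*} [CommSemiring R] (t : R) (u w : Finset (Fin h)) :
    ∏ a : Fin h, ∏ c : Fin h, t ^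
      ((fun k : Fin (h + h) => if (k : ℕ) < h then 2 ^ (k : ℕ) else 0)
          (if a ∈ u then Fin.castAdd h a else Fin.natAdd h a) *
        (fun l : Fin (h + h) => if (l : ℕ) < h then 0 else 2 ^ ((l : ℕ) - h))
          (if c ∈ w then Fin.natAdd h c else Fin.castAdd h c)) =
      t ^ ((∑ a ∈ u, 2 ^ (a : ℕ)) * ∑ c ∈ w, 2 ^ (c : ℕ)) := by
  simp_rw [rowW_ite, colW_ite, Finset.prod_pow_eq_pow_sum, ← Finset.mul_sum]
  rw [← Finset.sum_mul, sum_ite_eq_code, sum_ite_eq_code]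

end Kernel

section Main

variable {h r : ℕ}

/-- The specialised matrix `(T ^ (code u_i * code w_j))_{i,j}` over `ℤ[T]` has nonzero determinant when `u`, `w`
are injective. -/
theorem det_pow_code_ne_zero (u w : Fin r → Finset (Fin h)) (hu : Function.Injective u)
    (hw : Function.Injective w) :
    (Matrix.of fun i j : Fin r =>
      ((X : ℤ[X]) ^ ((∑ a ∈ u i, 2 ^ (a : ℕ)) * ∑ c ∈ w j, 2 ^ (c : ℕ)))).det ≠ 0 := by
  have hA : Function.Injective fun i => ∑ a ∈ u i, 2 ^ (a : ℕ) := code_injective.comp hu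
  have hB : Function.Injective fun j => ∑ c ∈ w j, 2 ^ (c : ℕ) := code_injective.comp hw
  obtain ⟨σ₀, hσ₀⟩ := exists_unique_max _ _ hA hB
  refine TropicalDet.det_ne_zero_of_unique_maxDegree _ σ₀ (fun j => ?_) (fun σ hσ => Or.inr ?_)
  · exact pow_ne_zero _ X_ne_zero
  · simp only [Matrix.of_apply, natDegree_pow, natDegree_X, mul_one]
    exact hσ₀ σ hσ

/-- **Free pair kernel, polynomial form.** With independent indeterminates `X (k, l)` on the literal pairs, the
`r × r` matrix `(∏_a ∏_c X (ρ_{u_i} a, τ_{w_j} c))_{i,j}` of two injective layouts has nonzero determinant in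
`MvPolynomial (Fin (h+h) × Fin (h+h)) ℤ`. -/
theorem freePairKernel_det_ne_zero (u w : Fin r → Finset (Fin h)) (hu : Function.Injective u)
    (hw : Function.Injective w) :
    (Matrix.of fun i j : Fin r => ∏ a : Fin h, ∏ c : Fin h,
      (MvPolynomial.X ((if a ∈ u i then Fin.castAdd h a else Fin.natAdd h a),
        (if c ∈ w j then Fin.natAdd h c else Fin.castAdd h c)) :
          MvPolynomial (Fin (h + h) × Fin (h + h)) ℤ)).det ≠ 0 := by
  intro hdet
  -- specialise `X (k, l) ↦ T ^ (w_row k * w_col l)`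
  set φ : MvPolynomial (Fin (h + h) × Fin (h + h)) ℤ →+* ℤ[X] :=
    (MvPolynomial.aeval fun kl : Fin (h + h) × Fin (h + h) => (X : ℤ[X]) ^
      ((fun k : Fin (h + h) => if (k : ℕ) < h then 2 ^ (k : ℕ) else 0) kl.1 *
        (fun l : Fin (h + h) => if (l : ℕ) < h then 0 else 2 ^ ((l : ℕ) - h)) kl.2)).toRingHom
    with hφ
  have himg := congrArg φ hdet
  rw [map_zero, RingHom.map_det] at himg
  refine det_pow_code_ne_zero u w hu hw ?_
  rw [← himg]
  congr 1
  refine Matrix.ext fun i j => ?_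
  simp only [RingHom.mapMatrix_apply, Matrix.map_apply, Matrix.of_apply, map_prod, hφ,
    AlgHom.toRingHom_eq_coe, RingHom.coe_coe, MvPolynomial.aeval_X]
  exact (prod_prod_pow_eq (X : ℤ[X]) (u i) (w j)).symm

/-- **Free pair kernel, complex points** (the statement of CT `TransversalResultantKernelNonsingular` with the
differences `p k − q l` replaced by a free table `Z k l`). -/
theorem exists_freePairKernel_det_ne_zero :
    ∀ (h r : ℕ) (u w : Fin r → Finset (Fin h)), Function.Injective u → Function.Injective w →
      ∃ Z : Fin (h + h) → Fin (h + h) → ℂ, (Matrix.of fun i j : Fin r => ∏ a : Fin h, ∏ c : Fin h,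
        Z (if a ∈ u i then Fin.castAdd h a else Fin.natAdd h a)
          (if c ∈ w j then Fin.natAdd h c else Fin.castAdd h c)).det ≠ 0 := by
  intro h r u w hu hw
  classical
  set P : ℤ[X] := (Matrix.of fun i j : Fin r =>
    ((X : ℤ[X]) ^ ((∑ a ∈ u i, 2 ^ (a : ℕ)) * ∑ c ∈ w j, 2 ^ (c : ℕ)))).det with hP
  have hP0 : P ≠ 0 := det_pow_code_ne_zero u w hu hw
  -- a nonzero integer polynomial has a natural non-root
  obtain ⟨n, hn⟩ : ∃ n : ℕ, P.eval (n : ℤ) ≠ 0 := by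
    by_contra hall
    push Not at hall
    apply hP0
    apply Polynomial.eq_zero_of_infinite_isRoot
    refine Set.infinite_of_injective_forall_mem (f := fun n : ℕ => (n : ℤ)) Nat.cast_injective fun n => ?_
    exact hall n
  refine ⟨fun k l => (n : ℂ) ^ ((fun k : Fin (h + h) => if (k : ℕ) < h then 2 ^ (k : ℕ) else 0) k *
    (fun l : Fin (h + h) => if (l : ℕ) < h then 0 else 2 ^ ((l : ℕ) - h)) l), ?_⟩
  -- the complex matrix is the image of the `ℤ[T]`-matrix under `eval₂ (Int.cast) n`
  set ψ : ℤ[X] →+* ℂ := Polynomial.eval₂RingHom (Int.castRingHom ℂ) (n : ℂ) with hψ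
  have hmat : (Matrix.of fun i j : Fin r => ∏ a : Fin h, ∏ c : Fin h,
      ((n : ℂ) ^ ((fun k : Fin (h + h) => if (k : ℕ) < h then 2 ^ (k : ℕ) else 0)
          (if a ∈ u i then Fin.castAdd h a else Fin.natAdd h a) *
        (fun l : Fin (h + h) => if (l : ℕ) < h then 0 else 2 ^ ((l : ℕ) - h))
          (if c ∈ w j then Fin.natAdd h c else Fin.castAdd h c)))) =
      ψ.mapMatrix (Matrix.of fun i j : Fin r =>
        ((X : ℤ[X]) ^ ((∑ a ∈ u i, 2 ^ (a : ℕ)) * ∑ c ∈ w j, 2 ^ (c : ℕ)))) := by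
    ext i j
    rw [RingHom.mapMatrix_apply, Matrix.map_apply, Matrix.of_apply, Matrix.of_apply, prod_prod_pow_eq,
      map_pow, hψ, Polynomial.coe_eval₂RingHom, Polynomial.eval₂_X]
  rw [hmat, ← RingHom.map_det]
  have heval : ψ P = ((P.eval (n : ℤ) : ℤ) : ℂ) := by
    rw [hψ, Polynomial.coe_eval₂RingHom, Polynomial.eval₂_at_natCast, eq_intCast]
  rw [← hP, heval]
  exact_mod_cast hn

end Main

end Summit.ValiantsHypothesis.ValiantsHypothesis.Theorems.BarrierLever.FreePairKernel
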